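import Mathlib
import Summits.NavierStokesRegularity.NavierStokesRegularity.Theses.TaoLadderRungOne
import HarnessLib

/-!
# `TaoLadderRungOne.Assembly` — the route's assembly (item stmt-NavierStokesRegularity-19874; pure
  logic)

**Statement.** `SplitCascadeIsAveragedNoDil → SplitCascadeBlowup → Target`.

PROOF. The route file `Theses/TaoLadderRungOne.lean` carries the planner-authored, kernel-checked
deciding theorem `Theses.TaoLadderRungOne.closes`, whose hypotheses are exactly the route's items
and whose conclusion is the registered leaf; the assembly item is that implication written as ONE
proposition, so it is closed by applying `closes` to the hypotheses.

HONEST FRAMING: glue between the route's own statements (about HYPOTHETICAL objects); nothing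
here bears on the regularity problem itself.
-/

noncomputable section

set_option linter.dupNamespace false

namespace Summit.NavierStokesRegularity.NavierStokesRegularity.Theorems

open Summit.NavierStokesRegularity.NavierStokesRegularity.Theses.TaoLadderRungOne in
/-- **Item stmt-NavierStokesRegularity-19874** (`TaoLadderRungOne.Assembly`): the route's chain of
items implies its registered leaf, by the route file's deciding theorem `closes`. [this file] -/
theorem taoLadderRungOne_assembly_proof :
    Summit.NavierStokesRegularity.NavierStokesRegularity.Theses.TaoLadderRungOne.Assembly := by
  unfold Summit.NavierStokesRegularity.NavierStokesRegularity.Theses.TaoLadderRungOne.Assembly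
  intro h₁ h₂
  exact closes h₁ h₂

end Summit.NavierStokesRegularity.NavierStokesRegularity.Theorems

end
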